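import Mathlib
import Summits.Ventures.PercRepro2.Tail2DBlockCalc
import Summits.Ventures.PercRepro2.Tail2DHarrisSP
import Summits.Ventures.PercRepro2.Tail2DFlowOneBlocks
import Summits.Ventures.PercRepro2.Tail2DFlowOneStep01
import Summits.Ventures.PercRepro2.Tail2DParFin
import Summits.Ventures.PercRepro2.Tail2DParFinFlip
import Summits.Ventures.PercRepro2.Tail2DParFinTop
import Summits.Ventures.PercRepro2.Tail2DParFinDiag
import Summits.Ventures.PercRepro2.Tail2DParFinCount
import Summits.Ventures.PercRepro2.Tail2DParFinRelax
import Summits.Ventures.PercRepro2.Tail2DParFinSubTop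
import Summits.Ventures.PercRepro2.Tail2DParFinSubTopB
import Summits.Ventures.PercRepro2.Tail2DParFinFibres
import Summits.Ventures.PercRepro2.Tail2DOneChange
import Summits.Ventures.PercRepro2.Tail2DOneChangeB
import Summits.Ventures.PercRepro2.Tail2DOneChangeC
import Summits.Ventures.PercRepro2.Tail2DFourIdent

/-!
# (SD) at `(5,0)` on `7` identical flow-one factors — an explicit one-change table
(seat mine-b, cell pub-perc-repro2; conjectures/MINE-B.md §44)

The rates are `P(c/a)/D(c/a)` with `P` of non-negative coefficients (found by an LP on the coefficients, verified
exactly; mining/mine-b/code/g42/k67_tables.json), applied through the generic theorem `sdomZ_of_oneChange`.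
-/

namespace Summit.Ventures.PercRepro2.Tail2D

open V2Closure Finset

namespace IdentSev50

/-- `D = 63 * a ^ 2 + 147 * a * c + 105 * c ^ 2` at `(5,0)` on `7` identical factors -/
noncomputable def dN (Y : V2Closure.SP) : ℚ := 63 * aY Y ^ 2 + 147 * aY Y * cY Y + 105 * cY Y ^ 2

/-- the identity rate by the type `(#R, #B)` -/
noncomputable def ιN (Y : V2Closure.SP) (r b : ℕ) : ℚ :=
  if r = 5 ∧ b = 1 then ((44 / 3 : ℚ) * aY Y ^ 2 + (17 / 2 : ℚ) * aY Y * cY Y + (7 / 2 : ℚ) * cY Y ^ 2) / dN Y else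
  if r = 6 ∧ b = 1 then (20 * aY Y ^ 2 + 28 * aY Y * cY Y + 6 * cY Y ^ 2) / dN Y else
  if r = 5 ∧ b = 2 then ((44 / 3 : ℚ) * aY Y ^ 2 + 17 * aY Y * cY Y + 20 * cY Y ^ 2) / dN Y else
  0

/-- the flip rate per red by the type -/
noncomputable def fN (Y : V2Closure.SP) (r b : ℕ) : ℚ :=
  if b = 0 then ((r : ℚ))⁻¹ else
  if r = 5 ∧ b = 1 then ((22 / 15 : ℚ) * aY Y ^ 2 + (97 / 10 : ℚ) * aY Y * cY Y + (21 / 2 : ℚ) * cY Y ^ 2) / dN Y else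
  if r = 6 ∧ b = 1 then ((10 / 3 : ℚ) * aY Y ^ 2 + (1 / 2 : ℚ) * cY Y ^ 2) / dN Y else
  if r = 5 ∧ b = 2 then ((19 / 3 : ℚ) * aY Y * cY Y + 7 * cY Y ^ 2) / dN Y else
  0

/-- the relax rate per red by the type -/
noncomputable def xN (Y : V2Closure.SP) (r b : ℕ) : ℚ :=
  if r = 5 ∧ b = 1 then ((41 / 5 : ℚ) * aY Y ^ 2 + (49 / 5 : ℚ) * aY Y * cY Y) / dN Y else
  if r = 6 ∧ b = 1 then ((23 / 6 : ℚ) * aY Y ^ 2 + 16 * aY Y * cY Y) / dN Y else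
  if r = 5 ∧ b = 2 then ((29 / 3 : ℚ) * aY Y ^ 2 + 10 * aY Y * cY Y) / dN Y else
  0

/-- the rate table -/
noncomputable def ratesN (Y : V2Closure.SP) : OCRates 7 where
  ι := fun w => ιN Y (nR 7 w) (nB 7 w)
  f := fun w _ => fN Y (nR 7 w) (nB 7 w)
  x := fun w _ => xN Y (nR 7 w) (nB 7 w)

variable {Y : V2Closure.SP}

/-- `D > 0` -/
theorem dN_pos (hR : 0 < (rSet Y).card) : 0 < dN Y := by
  unfold dN aY cY
  have : (0 : ℚ) < (rSet Y).card := by exact_mod_cast hR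
  positivity

/-- non-negativity of the rates -/
theorem ιN_nonneg (hR : 0 < (rSet Y).card) (r b : ℕ) : 0 ≤ ιN Y r b := by
  have := dN_pos hR
  have ha : (0 : ℚ) < aY Y := by unfold aY; exact_mod_cast hR
  have hc : (0 : ℚ) ≤ cY Y := by unfold cY; positivity
  unfold ιN
  positivity

/-- non-negativity of the rates -/
theorem ratesN_iota_nonneg (hR : 0 < (rSet Y).card) (w : Fin 7 → Ltr) : 0 ≤ (ratesN Y).ι w :=
  ιN_nonneg hR _ _

/-- non-negativity of the rates -/
theorem fN_nonneg (hR : 0 < (rSet Y).card) (r b : ℕ) : 0 ≤ fN Y r b := by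
  have := dN_pos hR
  have ha : (0 : ℚ) < aY Y := by unfold aY; exact_mod_cast hR
  have hc : (0 : ℚ) ≤ cY Y := by unfold cY; positivity
  unfold fN
  positivity

/-- non-negativity of the rates -/
theorem ratesN_f_nonneg (hR : 0 < (rSet Y).card) (w : Fin 7 → Ltr) (i : Fin 7) : 0 ≤ (ratesN Y).f w i :=
  fN_nonneg hR _ _

/-- non-negativity of the rates -/
theorem xN_nonneg (hR : 0 < (rSet Y).card) (r b : ℕ) : 0 ≤ xN Y r b := by
  have := dN_pos hR
  have ha : (0 : ℚ) < aY Y := by unfold aY; exact_mod_cast hR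
  have hc : (0 : ℚ) ≤ cY Y := by unfold cY; positivity
  unfold xN
  positivity

/-- non-negativity of the rates -/
theorem ratesN_x_nonneg (hR : 0 < (rSet Y).card) (w : Fin 7 → Ltr) (i : Fin 7) : 0 ≤ (ratesN Y).x w i :=
  xN_nonneg hR _ _

/-- `|E(5,0)|` -/
theorem tailCountN_src (hY : FlowOne Y) : (tailCount (parFin 7 (fun _ => Y)) 5 0 : ℚ) = aY Y ^ 5 * (29 * aY Y ^ 2 + 49 * aY Y * cY Y + 21 * cY Y ^ 2) := by
  rw [tailCount_parFin_ident 7 Y hY 5 0]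
  unfold aY cY
  simp only [Finset.sum_range_succ, Finset.sum_range_zero]
  norm_num [Nat.choose]
  ring

/-- `|E(4,1)|` -/
theorem tailCountN_tgt (hY : FlowOne Y) : (tailCount (parFin 7 (fun _ => Y)) 4 1 : ℚ) = aY Y ^ 5 * dN Y := by
  rw [tailCount_parFin_ident 7 Y hY 4 1]
  unfold dN aY cY
  simp only [Finset.sum_range_succ, Finset.sum_range_zero]
  norm_num [Nat.choose]
  ring

/-- `γ_i = c/a` -/
theorem gamN (i : Fin 7) : gam 7 (fun _ => Y) i = cY Y / aY Y := rfl

/-- **the source identity** -/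
theorem ratesN_srcOK (hR : 0 < (rSet Y).card) : (ratesN Y).SrcOK (fun _ => Y) 5 0 := by
  intro w hw
  have h3 := nR_add_nB_add_nC 7 w
  have ha : (0 : ℚ) < aY Y := by unfold aY; exact_mod_cast hR
  have hc : (0 : ℚ) ≤ cY Y := by unfold cY; positivity
  have hD := dN_pos hR
  have hsum : ∀ (φ : ℚ), ∑ i ∈ redSet 7 w, φ = (nR 7 w : ℚ) * φ := by
    intro φ; rw [Finset.sum_const, ← nR_eq_card_redSet, nsmul_eq_mul]
  have hι : ∀ w', (ratesN Y).ι w' = ιN Y (nR 7 w') (nB 7 w') := fun _ => rfl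
  have hf : ∀ w' i, (ratesN Y).f w' i = fN Y (nR 7 w') (nB 7 w') := fun _ _ => rfl
  have hx : ∀ w' i, (ratesN Y).x w' i = xN Y (nR 7 w') (nB 7 w') := fun _ _ => rfl
  simp only [gamN, hι, hf, hx]
  have hcases : (nR 7 w = 5 ∧ nB 7 w = 0) ∨ (nR 7 w = 6 ∧ nB 7 w = 0) ∨ (nR 7 w = 7 ∧ nB 7 w = 0) ∨ (nR 7 w = 5 ∧ nB 7 w = 1) ∨ (nR 7 w = 6 ∧ nB 7 w = 1) ∨ (nR 7 w = 5 ∧ nB 7 w = 2) := by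
    have := hw.1; omega
  have hcom : ocCom 7 5 0 w ↔ (5 ≤ nR 7 w ∧ 0 ≤ nB 7 w) ∧ 0 + 1 ≤ nB 7 w := Iff.rfl
  rcases hcases with ⟨hr, hb⟩ | ⟨hr, hb⟩ | ⟨hr, hb⟩ | ⟨hr, hb⟩ | ⟨hr, hb⟩ | ⟨hr, hb⟩ <;>
  · simp only [hcom, hr, hb, hsum, ιN, fN, xN]
    norm_num
    try unfold dN
    try field_simp
    try ring

/-- **the target identity** -/
theorem ratesN_tgtOK (hY : FlowOne Y) (hR : 0 < (rSet Y).card) : (ratesN Y).TgtOK (fun _ => Y) 5 0 := by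
  intro w0 ht
  have h3 := nR_add_nB_add_nC 7 w0
  have ha : (0 : ℚ) < aY Y := by unfold aY; exact_mod_cast hR
  have hc : (0 : ℚ) ≤ cY Y := by unfold cY; positivity
  have hD := dN_pos hR
  rw [tailCountN_src hY, tailCountN_tgt hY]
  have hι : ∀ w', (ratesN Y).ι w' = ιN Y (nR 7 w') (nB 7 w') := fun _ => rfl
  have hf : ∀ w' i, (ratesN Y).f w' i = fN Y (nR 7 w') (nB 7 w') := fun _ _ => rfl
  have hx : ∀ w' i, (ratesN Y).x w' i = xN Y (nR 7 w') (nB 7 w') := fun _ _ => rfl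
  simp only [hι, hf, hx]
  have hsumB : ∑ j ∈ blueSet 7 w0, (fN Y (nR 7 (Function.update w0 j Ltr.R)) (nB 7 (Function.update w0 j Ltr.R))
      + (if ocCom 7 5 0 (Function.update w0 j Ltr.R)
          then xN Y (nR 7 (Function.update w0 j Ltr.R)) (nB 7 (Function.update w0 j Ltr.R)) else 0))
      = (nB 7 w0 : ℚ) * (fN Y (nR 7 w0 + 1) (nB 7 w0 - 1)
          + (if (5 ≤ nR 7 w0 + 1 ∧ 0 ≤ nB 7 w0 - 1) ∧ 0 + 1 ≤ nB 7 w0 - 1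
            then xN Y (nR 7 w0 + 1) (nB 7 w0 - 1) else 0)) := by
    rw [nB_eq_card_blueSet, ← nsmul_eq_mul, ← Finset.sum_const]
    apply Finset.sum_congr rfl
    intro j hj
    have hjB : w0 j = Ltr.B := by simpa [blueSet] using hj
    have e1 := nR_update_R 7 w0 j (by rw [hjB]; exact Ltr.noConfusion)
    have e2 := nB_update_R_of_B 7 w0 j hjB
    have e2' : nB 7 (Function.update w0 j Ltr.R) = nB 7 w0 - 1 := by omega
    have hcom : ocCom 7 5 0 (Function.update w0 j Ltr.R)
        ↔ (5 ≤ nR 7 (Function.update w0 j Ltr.R) ∧ 0 ≤ nB 7 (Function.update w0 j Ltr.R))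
          ∧ 0 + 1 ≤ nB 7 (Function.update w0 j Ltr.R) := Iff.rfl
    simp only [hcom, e1, e2']
    rw [nB_eq_card_blueSet]
  have hsumC : ∑ l ∈ cSet 7 w0, xN Y (nR 7 (Function.update w0 l Ltr.R)) (nB 7 (Function.update w0 l Ltr.R))
      = (nC 7 w0 : ℚ) * xN Y (nR 7 w0 + 1) (nB 7 w0) := by
    show _ = ((cSet 7 w0).card : ℚ) * _
    rw [← nsmul_eq_mul, ← Finset.sum_const]
    apply Finset.sum_congr rfl
    intro l hl
    have hlC : w0 l = Ltr.C := by simpa [cSet] using hl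
    have e1 := nR_update_R 7 w0 l (by rw [hlC]; exact Ltr.noConfusion)
    have e2 := nB_update_R_of_ne 7 w0 l (by rw [hlC]; exact Ltr.noConfusion)
    rw [e1, e2]
  rw [hsumB, hsumC]
  have hcases : (nR 7 w0 = 4 ∧ nB 7 w0 = 1) ∨ (nR 7 w0 = 5 ∧ nB 7 w0 = 1) ∨ (nR 7 w0 = 6 ∧ nB 7 w0 = 1) ∨ (nR 7 w0 = 4 ∧ nB 7 w0 = 2) ∨ (nR 7 w0 = 5 ∧ nB 7 w0 = 2) ∨ (nR 7 w0 = 4 ∧ nB 7 w0 = 3) := by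
    have := ht.1; have := ht.2; omega
  have hcom : ocCom 7 5 0 w0 ↔ (5 ≤ nR 7 w0 ∧ 0 ≤ nB 7 w0) ∧ 0 + 1 ≤ nB 7 w0 := Iff.rfl
  rcases hcases with ⟨hr, hb⟩ | ⟨hr, hb⟩ | ⟨hr, hb⟩ | ⟨hr, hb⟩ | ⟨hr, hb⟩ | ⟨hr, hb⟩ <;>
  · have hnC : nC 7 w0 = 7 - nR 7 w0 - nB 7 w0 := by omega
    simp only [hcom, hr, hb, hnC, ιN, fN, xN]
    norm_num
    try unfold dN
    try field_simp
    try ring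

/-- **(SD) at `(5,0)` on `7` identical factors** -/
theorem sdomZ_ident_Sev50 (hY : FlowOne Y) (hR : 0 < (rSet Y).card) : SDomZ (parFin 7 (fun _ => Y)) 5 0 :=
  sdomZ_of_oneChange (fun _ => hY) (fun _ => hR) (by norm_num) (ratesN Y) (ratesN_iota_nonneg hR)
    (ratesN_f_nonneg hR) (ratesN_x_nonneg hR) (ratesN_srcOK hR) (ratesN_tgtOK hY hR)

end IdentSev50

end Summit.Ventures.PercRepro2.Tail2D
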